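import Mathlib.Analysis.Calculus.IteratedDeriv.Lemmas
import Mathlib.Analysis.Calculus.ContDiff.Basic
import Mathlib.Topology.Instances.ENNReal.Lemmas
import HarnessLib

/-!
# Zero extension of forces vanishing near the final time; weighted sup-norms tending to zero

Topic `Literature/Analysis/ODE` (namespace `Literature.Analysis.ODE`). Two pieces of bookkeeping from
the last paragraph of §3.3 of S. Palasek, arXiv:2605.13827 (proof of Thm 1.3): (a) "Since each `f_k`
vanishes in a neighborhood of `t = 0` [the blow-up time], we may extend it by `0` to obtain an
`f ∈ C_t^∞([-T, ∞); 𝒞^∞)`"; (b) Rem. 1.4: "`‖f(t)‖_{𝒞^s} → 0` as `t → T_*`" because at times close to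
the blow-up time only high modes are forced and their weighted sizes form a null sequence.

* `contDiffOn_Ici_zeroExtension` — if `g` is `C^∞` on `[0, T]` and vanishes on `[T - τ, T]`
  (`τ > 0`), then `t ↦ (t ≤ T ? g t : 0)` is `C^∞` on `[0, ∞)`;
  `iteratedDerivWithin_zeroExtension_of_lt` / `…_eq_zero` — its iterated derivatives within
  `[0, ∞)` are those of `g` within `[0, T]` on `[0, T)`, and vanish for `t > T - τ`.
* `tendsto_iSup_ofReal_nhdsLT` — if `g k t ≤ b k` for `t < T` with `b k → 0`, and mode `k` is
  switched off on `(T - τ k, T)` (`τ k > 0`), then `⨆_k ofReal (g k t) → 0` as `t ↑ T` (finitely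
  many low modes are off near `T`, the rest are uniformly small).

All proved, no definitions, no named facts; Mathlib-only.

## References

* S. Palasek, *Finite-time blow-up in an elementary model of the 3D Navier–Stokes equations*,
  arXiv:2605.13827 (2026), §3.3 (end of the proof of Thm 1.3) and Rem. 1.4.
  Key `Palasek2026ElementaryModel`.
-/

noncomputable section

open Set Filter
open scoped Topology ContDiff ENNReal

namespace Literature.Analysis.ODE

section ZeroExtension

variable {g : ℝ → ℝ} {T τ : ℝ}

/-- Near a point `t < T` of `[0, ∞)`, the zero extension agrees with `g` within `[0, ∞)`.
[folklore] -/
private theorem zeroExtension_eventuallyEq_of_lt {t : ℝ} (ht : t < T) :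
    (fun s => if s ≤ T then g s else 0) =ᶠ[𝓝[Ici 0] t] g := by
  filter_upwards [mem_nhdsWithin_of_mem_nhds (Iio_mem_nhds ht)] with s hs
  rw [if_pos (le_of_lt hs)]

/-- Near a point `t > T - τ`, the zero extension of a `g` vanishing on `[T - τ, T]` is `0`.
[folklore] -/
private theorem zeroExtension_eventuallyEq_zero {t : ℝ} (hvanish : ∀ s ∈ Icc (T - τ) T, g s = 0)
    (ht : T - τ < t) : (fun s => if s ≤ T then g s else 0) =ᶠ[𝓝 t] fun _ => 0 := by
  filter_upwards [Ioi_mem_nhds ht] with s hs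
  split_ifs with h
  · exact hvanish s ⟨le_of_lt hs, h⟩
  · rfl

/-- For `t < T`, `[0, T]` is a neighbourhood of `t` within `[0, ∞)`. [folklore] -/
private theorem Icc_mem_nhdsWithin_Ici_of_lt {t : ℝ} (ht : t < T) : Icc 0 T ∈ 𝓝[Ici 0] t := by
  have : Ici (0 : ℝ) ∩ Iio T ⊆ Icc 0 T := fun s hs => ⟨hs.1, le_of_lt hs.2⟩
  exact mem_of_superset (inter_mem_nhdsWithin _ (Iio_mem_nhds ht)) this

/-- For `t < T`, the sets `[0, ∞)` and `[0, T]` coincide near `t`. [folklore] -/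
private theorem Ici_eventuallyEq_Icc_of_lt {t : ℝ} (ht : t < T) :
    (Ici (0 : ℝ) : Set ℝ) =ᶠ[𝓝 t] Icc 0 T := by
  filter_upwards [Iio_mem_nhds ht] with s hs
  simp only [eq_iff_iff]
  exact ⟨fun h => ⟨h, le_of_lt hs⟩, fun h => h.1⟩

/-- **Zero extension of a smooth force vanishing near the final time.** If `g` is `C^∞` on
`[0, T]` (`T > 0`) and `g = 0` on `[T - τ, T]` for some `τ > 0`, then the function equal to `g` on
`(-∞, T]` and to `0` afterwards is `C^∞` on `[0, ∞)` ("we may extend it by `0` to obtain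
`f ∈ C_t^∞([-T, ∞); 𝒞^∞)`"). [cite: Palasek2026ElementaryModel, §3.3 end of proof of Thm 1.3] -/
theorem contDiffOn_Ici_zeroExtension (hτ : 0 < τ) (hg : ContDiffOn ℝ ∞ g (Icc 0 T))
    (hvanish : ∀ s ∈ Icc (T - τ) T, g s = 0) :
    ContDiffOn ℝ ∞ (fun t => if t ≤ T then g t else 0) (Ici 0) := by
  intro t ht
  by_cases htT : t < T
  · have h1 : ContDiffWithinAt ℝ ∞ g (Ici 0) t :=
      (hg t ⟨ht, htT.le⟩).mono_of_mem_nhdsWithin (Icc_mem_nhdsWithin_Ici_of_lt htT)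
    exact h1.congr_of_eventuallyEq (zeroExtension_eventuallyEq_of_lt htT) (by simp [htT.le])
  · have htτ : T - τ < t := by linarith [not_lt.1 htT]
    have h0 : ContDiffWithinAt ℝ ∞ (fun _ : ℝ => (0 : ℝ)) (Ici 0) t := contDiffWithinAt_const
    refine h0.congr_of_eventuallyEq
      (mem_nhdsWithin_of_mem_nhds (zeroExtension_eventuallyEq_zero hvanish htτ)) ?_
    have := (zeroExtension_eventuallyEq_zero (g := g) hvanish htτ).self_of_nhds
    simpa using this

/-- On `[0, T)` the iterated derivatives of the zero extension within `[0, ∞)` are those of `g`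
within `[0, T]`. [cite: Palasek2026ElementaryModel, §3.3 end of proof of Thm 1.3] -/
theorem iteratedDerivWithin_zeroExtension_of_lt {t : ℝ} (htT : t < T) (n : ℕ) :
    iteratedDerivWithin n (fun s => if s ≤ T then g s else 0) (Ici 0) t =
      iteratedDerivWithin n g (Icc 0 T) t := by
  rw [(zeroExtension_eventuallyEq_of_lt (g := g) htT).iteratedDerivWithin_eq (by simp [htT.le])]
  rw [iteratedDerivWithin_eq_iteratedFDerivWithin, iteratedDerivWithin_eq_iteratedFDerivWithin,
    iteratedFDerivWithin_congr_set (Ici_eventuallyEq_Icc_of_lt htT)]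

/-- Beyond `T - τ` all iterated derivatives of the zero extension within `[0, ∞)` vanish.
[cite: Palasek2026ElementaryModel, §3.3 end of proof of Thm 1.3] -/
theorem iteratedDerivWithin_zeroExtension_eq_zero (hvanish : ∀ s ∈ Icc (T - τ) T, g s = 0)
    {t : ℝ} (ht : T - τ < t) (n : ℕ) :
    iteratedDerivWithin n (fun s => if s ≤ T then g s else 0) (Ici 0) t = 0 := by
  have h := zeroExtension_eventuallyEq_zero (g := g) hvanish ht
  have h' : (fun s => if s ≤ T then g s else 0) =ᶠ[𝓝[Ici 0] t] fun _ => (0 : ℝ) :=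
    mem_nhdsWithin_of_mem_nhds h
  rw [h'.iteratedDerivWithin_eq (by simpa using h.self_of_nhds)]
  simp

end ZeroExtension

section Tail

/-- **Weighted sup-norm of the force tends to zero at the final time.** Let `g k t ≤ b k` for
`t < T` with `b k → 0`, and let mode `k` be switched off just before `T`: `g k t ≤ 0` for
`T - τ k < t < T`, `τ k > 0`. Then `⨆_k ofReal (g k t) → 0` as `t ↑ T` — near `T` the finitely
many low modes are off and the high ones are uniformly small ("‖f(t)‖_{𝒞^s} → 0 as t → T_*": at
times close to the blow-up time only high modes are forced). [cite: Palasek2026ElementaryModel, §1.2 Rem. 1.4 and §3.3] -/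
theorem tendsto_iSup_ofReal_nhdsLT {g : ℕ → ℝ → ℝ} {b τ : ℕ → ℝ} {T : ℝ}
    (hb : Tendsto b atTop (𝓝 0)) (hgb : ∀ k t, t < T → g k t ≤ b k) (hτ : ∀ k, 0 < τ k)
    (hoff : ∀ k t, T - τ k < t → t < T → g k t ≤ 0) :
    Tendsto (fun t => ⨆ k, ENNReal.ofReal (g k t)) (𝓝[<] T) (𝓝 0) := by
  rw [ENNReal.tendsto_nhds_zero]
  intro ε hε
  -- high modes: `b k < ε'` for `k ≥ K`, with a real `ε' ≤ ε`
  have hε' : ∃ ε' : ℝ, 0 < ε' ∧ ENNReal.ofReal ε' ≤ ε := by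
    rcases eq_or_ne ε ⊤ with h | h
    · exact ⟨1, one_pos, by simp [h]⟩
    · refine ⟨ε.toReal, ENNReal.toReal_pos hε.ne' h, ?_⟩
      rw [ENNReal.ofReal_toReal h]
  obtain ⟨ε', hε'0, hε'ε⟩ := hε'
  obtain ⟨K, hK⟩ := eventually_atTop.1 ((tendsto_order.1 hb).2 ε' hε'0)
  -- low modes: off on `(T - δ, T)` with `δ = min_{k < K} τ k`
  have hδ : ∀ K : ℕ, ∃ δ, 0 < δ ∧ ∀ k, k < K → δ ≤ τ k := by
    intro K
    induction K with
    | zero => exact ⟨1, one_pos, fun k hk => absurd hk (Nat.not_lt_zero k)⟩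
    | succ K ih =>
      obtain ⟨δ, hδ0, hδK⟩ := ih
      refine ⟨min δ (τ K), lt_min hδ0 (hτ K), fun k hk => ?_⟩
      rcases Nat.lt_succ_iff_lt_or_eq.1 hk with h | h
      · exact (min_le_left _ _).trans (hδK k h)
      · rw [h]; exact min_le_right _ _
  obtain ⟨δ, hδ0, hδK⟩ := hδ K
  filter_upwards [Ioo_mem_nhdsLT (sub_lt_self T hδ0)] with t ht
  refine iSup_le fun k => ?_
  rcases lt_or_ge k K with hk | hk
  · -- a low mode, switched off
    have h1 : g k t ≤ 0 := hoff k t (by linarith [hδK k hk, ht.1]) ht.2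
    rw [ENNReal.ofReal_of_nonpos h1]
    exact bot_le
  · -- a high mode, uniformly small
    have h1 : g k t ≤ ε' := (hgb k t ht.2).trans (hK k hk).le
    exact (ENNReal.ofReal_le_ofReal h1).trans hε'ε

end Tail

end Literature.Analysis.ODE
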